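import Summits.KontsevichZagierPeriods.Zeta5Search.Certificates.VIML3Defs
import HarnessLib

/-!
# ζ(5) search — brown9 LEVEL 3: packed integer rows for large reflected data (cell `pub-zeta5`, certifier `cert-1`)

HONEST FRAMING: systematic search; recurrence certificates; no irrationality claim unless certified.

The level-3 certificate numerators (`VIML3CertM*.lean`) have ~2850 integer coefficients each; a list literal of that
length is too slow to ELABORATE (tens of ms per numeral), while the kernel handles big naturals natively. So each data
row (the coefficient list in `n` of one power of `x`) is shipped as ONE natural number: `k` signed digits in base `2^m`
with offset `2^(m−1)`, least significant first, decoded by `unpack k m N` (kernel-side `Nat.mod`/`Nat.div`). Nothing is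
claimed about `unpack`: the replay proves identities about exactly the decoded polynomials. No named facts.
-/

namespace Summit.KontsevichZagierPeriods.Zeta5Search.Certificates

namespace VIMInner.L3

/-- Decode `k` signed base-`2^m` digits (offset `2^(m-1)`) of `N`, least significant first. -/
def unpack : ℕ → ℕ → ℕ → List ℤ
  | 0, _, _ => []
  | k + 1, m, N => (((N % 2 ^ m : ℕ) : ℤ) - ((2 ^ (m - 1) : ℕ) : ℤ)) :: unpack k m (N / 2 ^ m)

/-- Example: `unpack 3 4 (5 + 16·8 + 256·11) = [5 − 8, 8 − 8, 11 − 8]`. -/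
example : unpack 3 4 (5 + 16 * 8 + 256 * 11) = [-3, 0, 3] := by decide

end VIMInner.L3

end Summit.KontsevichZagierPeriods.Zeta5Search.Certificates
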